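import Summits.CriticalPhenomena.PercolationContinuityZ3.Theorems.PercNearOneGluingNoHeavyQuantDepthOneRelayRow
import Summits.CriticalPhenomena.PercolationContinuityZ3.Theorems.PercNearOneGluingNoHeavyQuantDepthOneRows
import HarnessLib

/-!
# QUANT lane R8, GRADED-CLOSURE programme: G₀ for EVERY PARTNER — part 1, the pointwise certificate with abstract hole data

builds on p205010 (kernel theorem, internal audit signed; external expert review pending)

Support file (`--supports stmt-CriticalPhenomena-4575`), QUANT lane seat prim-quant-arm-1 (gen 44, architect seat), rung R8 of
`run/shared/lean/prim/quant/LADDER.md`; memo `run/shared/lean/prim/quant/prim-quant-arm-1-g44/G0-SUBUNIT-G44.md` §7 (Theorem 3).  Part 1 of 2: this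
file proves the CELL-BY-CELL inequality of the general-partner certificate against ABSTRACT data (hole weights `κ`, hole thresholds `B`, mixing weights `w`
and mixing layers `hs`, subject to eight elementary relations); part 2 (`…QuantDepthOneGeneralRow`) constructs the data (`B h = min(h−m, j₀−h)`,
`κ h = 1/usage(d,h)`, `hs b = j₀ − ⌈T₂−b⌉₊`, `w b = κ (hs b)`) and sums.  Theorems only, standard axioms, no sorries.

THE CERTIFICATE (q = 1, any floor `0 < y < 1`, `u = y/(1−y)`; product row `d` of `μ₁ ∗ μ₂` at `T = T₁+T₂`, `2d < T₁`, `j₀ < T−d ≤ j₀+1`, `m−1 ≤ T₁−d < m`).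
Column `b ≤ d` of the product grid carries the factor-1 rows `(1 − w b)·TLC(j₀−b, d−b) + (w b)·TLC(hs b, d−b)`; the atom `a` carries `κ a ×` the partner's
two-layer row with threshold `B a` (`u[b ≤ B a] − [T₂ − B a ≤ b]`).  HOLES are the atoms `h ∈ [m, j₀]` (the compatible mids of column 0); `h` is a mid of
column `b` iff `b ≤ B h = min(h−m, j₀−h)`; its partner row pays every hole cell (`κ h ≥ 1/usage(d−b, h)`), vanishes on the dead zone `B h < b < T₂ − B h`, and
costs `κ h` on the columns `b ≥ T₂ − B h`, where column `b` is MIXED (`hs b ≥ h`, `w b ≥ κ h`) so that the room `w b` on `[j₀−b+1, hs b] ∋ h` pays for it.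
`general_pointwise`: under these relations `u[a+b ≤ d] − [T−d ≤ a+b] ≤` the certificate's value at every cell `(a, b) ∈ ℕ²`.
EVIDENCE / STATUS: the concrete certificate of part 2 was verified exactly on 224 316 cells (memo §7: every partner `M₂ ≤ 15`, any `T₂`, ten floors,
`M₁ ≤ 24`, every row with `2d < T₁` and a heavy top hole): 0 failures.  A support lemma for the OPEN node G₀ (`LawDec.TLCGateConvTLB`); nothing here
changes the lane's RATE class log\* or honest sentence (`run/shared/lean/prim/quant/README.md`).  Special cases already in the tree / filed:
`…QuantDepthOneSubUnitRow` (✓ p383717, `T₂ ≤ 1`), `…QuantDepthOneSubTwo{Pointwise,Row}` (p384064/p384084, `T₂ ≤ 2`).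

[this work]; relay case / depth-1 rows: prim-quant-census-2 g63/g64; tensor principle: prim-quant-arm-2 g38.  Nothing here is cited as a published
result.  The gluing rows served [cite: KozmaNitzan2024, Conjecture 3 (p. 15)]; product measure [cite: Grimmett1999, §1.3 p. 10].
-/

noncomputable section

namespace Summit.CriticalPhenomena.PercolationContinuityZ3.Theorems

namespace Quant

open Finset

namespace LawDec

/-- **the pointwise certificate inequality for a general partner** (memo §7).  Abstract data: hole weights `κ`, hole thresholds `B`, mixing
weights `w`, mixing layers `hs`; the hypotheses `hκ*`, `hB*`, `hw0`, `hmix`, `hhs` are the relations listed in the file header (a mixed column has no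
compatible mids because `hs b ≤ T₁ − d + b`, so no separate 'hole columns are unmixed' hypothesis is needed).
For every cell `(a, b)`: `u[a+b ≤ d] − [T₁+T₂−d ≤ a+b] ≤ [b ≤ d]((1 − w b)·C_{j₀−b,d−b}(a) + (w b)·C_{hs b,d−b}(a)) + κ a·(u[b ≤ B a] − [T₂ − B a ≤ b])`.
[this work] -/
theorem general_pointwise (y T₁ T₂ : ℝ) (d j₀ m : ℕ) (κ w : ℕ → ℝ) (B hs : ℕ → ℕ) (a b : ℕ)
    (hy0 : 0 < y) (hy1 : y < 1) (hT20 : 0 < T₂) (hlow : 2 * (d : ℝ) < T₁)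
    (hj0 : (j₀ : ℝ) < T₁ + T₂ - d) (hj0' : T₁ + T₂ - d ≤ (j₀ : ℝ) + 1) (hm : (m : ℝ) - 1 ≤ T₁ - d) (hm' : T₁ - d < (m : ℝ))
    (hκ0 : ∀ (h : ℕ), 0 ≤ κ h) (hκ1 : ∀ (h : ℕ), κ h ≤ 1) (hκout : ∀ (h : ℕ), ¬ (m ≤ h ∧ h ≤ j₀) → κ h = 0)
    (hκhole : ∀ (h b' : ℕ), m ≤ h → h ≤ j₀ → b' ≤ B h → b' ≤ d → 1 / usage y T₁ (j₀ - b') (d - b') h ≤ κ h)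
    (hB : ∀ (h : ℕ), m ≤ h → h ≤ j₀ → m + B h ≤ h ∧ h + B h ≤ j₀)
    (hBmax : ∀ (h b' : ℕ), b' ≤ d → m + b' ≤ h → h + b' ≤ j₀ → b' ≤ B h)
    (hw0 : ∀ (b' : ℕ), 0 ≤ w b')
    (hmix : ∀ (b' h : ℕ), m ≤ h → h ≤ j₀ → T₂ - (B h : ℝ) ≤ (b' : ℝ) → h ≤ hs b' ∧ κ h ≤ w b')
    (hhs : ∀ (b' : ℕ), 0 < w b' → j₀ ≤ hs b' + b' ∧ hs b' ≤ j₀ ∧ ((hs b' : ℕ) : ℝ) ≤ T₁ - d + b') :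
    y / (1 - y) * (if a + b ≤ d then (1 : ℝ) else 0) - (if T₁ + T₂ - d ≤ ((a + b : ℕ) : ℝ) then (1 : ℝ) else 0)
      ≤ (if b ≤ d then (1 - w b) * (y / (1 - y) * (if a ≤ (d - b) then (1 : ℝ) else 0) - (if (j₀ - b) + 1 ≤ a then (1 : ℝ) else 0) - y / (1 - y) * (if a ≤ (j₀ - b) ∧ T₁ < ((d - b : ℕ) : ℝ) + a then 1 / usage y T₁ (j₀ - b) (d - b) a else 0)) + w b * (y / (1 - y) * (if a ≤ (d - b) then (1 : ℝ) else 0) - (if (hs b) + 1 ≤ a then (1 : ℝ) else 0) - y / (1 - y) * (if a ≤ (hs b) ∧ T₁ < ((d - b : ℕ) : ℝ) + a then 1 / usage y T₁ (hs b) (d - b) a else 0)) else 0)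
        + κ a * (y / (1 - y) * (if b ≤ B a then (1 : ℝ) else 0) - (if T₂ - (B a : ℝ) ≤ (b : ℝ) then (1 : ℝ) else 0)) := by
  have h1y : 0 < 1 - y := by linarith
  have hu0 : 0 < y / (1 - y) := div_pos hy0 h1y
  -- a row without compatible mids (local form of `tlcCoeff_of_not_mid`)
  have hnotmid : ∀ (j i n : ℕ), ¬ (n ≤ j ∧ T₁ < ((i : ℕ) : ℝ) + n) →
      (y / (1 - y) * (if n ≤ i then (1 : ℝ) else 0) - (if j + 1 ≤ n then (1 : ℝ) else 0)
        - y / (1 - y) * (if n ≤ j ∧ T₁ < ((i : ℕ) : ℝ) + n then 1 / usage y T₁ j i n else 0))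
      = y / (1 - y) * (if n ≤ i then (1 : ℝ) else 0) - (if j + 1 ≤ n then (1 : ℝ) else 0) := by
    intro j i n h; rw [if_neg h]; ring
  have hdj : d ≤ j₀ := by
    have : (d : ℝ) < j₀ + 1 := by linarith
    have : d < j₀ + 1 := by exact_mod_cast this
    omega
  have hgiant : ∀ n : ℕ, (T₁ + T₂ - d ≤ (n : ℝ)) ↔ j₀ + 1 ≤ n := by
    intro n; constructor
    · intro h
      have : (j₀ : ℝ) < n := by linarith
      exact Nat.succ_le_of_lt (by exact_mod_cast this)
    · exact fun h => le_trans hj0' (by exact_mod_cast h)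
  have hG : (if T₁ + T₂ - d ≤ ((a + b : ℕ) : ℝ) then (1 : ℝ) else 0) = (if j₀ + 1 ≤ a + b then (1 : ℝ) else 0) := by
    by_cases h : j₀ + 1 ≤ a + b
    · rw [if_pos ((hgiant _).2 h), if_pos h]
    · rw [if_neg (fun h' => h ((hgiant _).1 h')), if_neg h]
  rw [hG]
  have hj0m : (j₀ : ℝ) < m + T₂ := by linarith
  -- the partner part P and its sign structure
  have hP_nonneg_of : ¬ (T₂ - (B a : ℝ) ≤ (b : ℝ)) → 0 ≤ κ a * (y / (1 - y) * (if b ≤ B a then (1 : ℝ) else 0) - (if T₂ - (B a : ℝ) ≤ (b : ℝ) then (1 : ℝ) else 0)) := by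
    intro hnb; rw [if_neg hnb, sub_zero]
    refine mul_nonneg (hκ0 a) (mul_nonneg hu0.le ?_); split_ifs <;> norm_num
  -- when the partner row of `a` is negative at `b`: `a` is a hole, `a + b ≥ j₀ + 1`
  have hneg : T₂ - (B a : ℝ) ≤ (b : ℝ) → 0 < κ a → (m ≤ a ∧ a ≤ j₀) ∧ j₀ + 1 ≤ a + b := by
    intro hb hk
    have hhole : m ≤ a ∧ a ≤ j₀ := by
      by_contra hc; exact absurd (hκout a hc) (ne_of_gt hk)
    refine ⟨hhole, ?_⟩
    obtain ⟨h1, h2⟩ := hB a hhole.1 hhole.2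
    have h1r : (m : ℝ) + B a ≤ a := by exact_mod_cast h1
    have : (j₀ : ℝ) < a + b := by linarith
    have : j₀ < a + b := by exact_mod_cast this
    omega
  have hP_lb : -(κ a) * (if T₂ - (B a : ℝ) ≤ (b : ℝ) then (1 : ℝ) else 0) ≤ κ a * (y / (1 - y) * (if b ≤ B a then (1 : ℝ) else 0) - (if T₂ - (B a : ℝ) ≤ (b : ℝ) then (1 : ℝ) else 0)) := by
    have hI1 : 0 ≤ (if b ≤ B a then (1 : ℝ) else 0) := by split_ifs <;> norm_num
    have e : κ a * (y / (1 - y) * (if b ≤ B a then (1 : ℝ) else 0) - (if T₂ - (B a : ℝ) ≤ (b : ℝ) then (1 : ℝ) else 0))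
        = κ a * (y / (1 - y)) * (if b ≤ B a then (1 : ℝ) else 0) - κ a * (if T₂ - (B a : ℝ) ≤ (b : ℝ) then (1 : ℝ) else 0) := by ring
    rw [e]; nlinarith [mul_nonneg (mul_nonneg (hκ0 a) hu0.le) hI1]
  by_cases hbd : b ≤ d
  · rw [if_pos hbd]
    have hcast : ((d - b : ℕ) : ℝ) = (d : ℝ) - b := by rw [Nat.cast_sub hbd]
    have hb0r : (0 : ℝ) ≤ b := Nat.cast_nonneg b
    have e1 : (if a + b ≤ d then (1 : ℝ) else 0) = (if a ≤ d - b then (1 : ℝ) else 0) := by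
      by_cases h : a + b ≤ d
      · rw [if_pos h, if_pos (by omega)]
      · rw [if_neg h, if_neg (by omega)]
    have e2 : (if j₀ + 1 ≤ a + b then (1 : ℝ) else 0) = (if j₀ - b + 1 ≤ a then (1 : ℝ) else 0) := by
      by_cases h : j₀ + 1 ≤ a + b
      · rw [if_pos h, if_pos (by omega)]
      · rw [if_neg h, if_neg (by omega)]
    rw [e1, e2]
    by_cases hwb : 0 < w b
    · ------------------------------------------------------------- mixed column (or column 0 with a vacuous mix)
      obtain ⟨hs1, hs2, hs3⟩ := hhs b hwb
      -- no mids in the mixed-in row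
      have hnm2 : ¬ (a ≤ hs b ∧ T₁ < ((d - b : ℕ) : ℝ) + a) := by
        rintro ⟨h1, h2⟩; rw [hcast] at h2
        have : ((hs b : ℕ) : ℝ) < a := by linarith
        have : hs b < a := by exact_mod_cast this
        omega
      rw [hnotmid (hs b) (d - b) a hnm2]
      by_cases hmid : a ≤ j₀ - b ∧ T₁ < ((d - b : ℕ) : ℝ) + a
      · -- a would be a compatible mid of the main row above the mixed layer: impossible
        exfalso
        have h2 := hmid.2; rw [hcast] at h2
        have : ((hs b : ℕ) : ℝ) < a := by linarith
        have : hs b < a := by exact_mod_cast this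
        omega
      · -- a is not a mid of the main row
        rw [hnotmid (j₀ - b) (d - b) a hmid]
        have hI0 : 0 ≤ (if j₀ - b + 1 ≤ a then (1 : ℝ) else 0) := by split_ifs <;> norm_num
        have hroom : (if hs b + 1 ≤ a then (1 : ℝ) else 0) ≤ (if j₀ - b + 1 ≤ a then (1 : ℝ) else 0) := by
          by_cases h : hs b + 1 ≤ a
          · rw [if_pos h, if_pos (by omega)]
          · rw [if_neg h]; split_ifs <;> norm_num
        by_cases hnb : T₂ - (B a : ℝ) ≤ (b : ℝ)
        · by_cases hk : 0 < κ a
          · obtain ⟨⟨hm1, hm2⟩, hab⟩ := hneg hnb hk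
            obtain ⟨hle, hkw⟩ := hmix b a hm1 hm2 hnb
            have hga : j₀ - b + 1 ≤ a := by omega
            have hna : ¬ (hs b + 1 ≤ a) := by omega
            rw [if_pos hga, if_neg hna]
            have hPv : κ a * (y / (1 - y) * (if b ≤ B a then (1 : ℝ) else 0) - (if T₂ - (B a : ℝ) ≤ (b : ℝ) then (1 : ℝ) else 0)) = κ a * (y / (1 - y) * (if b ≤ B a then (1 : ℝ) else 0)) - κ a := by
              rw [if_pos hnb]; ring
            rw [hPv]
            have : 0 ≤ κ a * (y / (1 - y) * (if b ≤ B a then (1 : ℝ) else 0)) := by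
              refine mul_nonneg (hκ0 a) (mul_nonneg hu0.le ?_); split_ifs <;> norm_num
            nlinarith [this, hkw]
          · have hk0 : κ a = 0 := le_antisymm (not_lt.1 hk) (hκ0 a)
            have hPv : κ a * (y / (1 - y) * (if b ≤ B a then (1 : ℝ) else 0) - (if T₂ - (B a : ℝ) ≤ (b : ℝ) then (1 : ℝ) else 0)) = 0 := by rw [hk0]; ring
            rw [hPv]
            nlinarith [hroom, hI0, hw0 b]
        · have hP0 := hP_nonneg_of hnb
          nlinarith [hroom, hI0, hw0 b, hP0]
    · ------------------------------------------------------------- unmixed column (w b = 0)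
      have hw00 : w b = 0 := le_antisymm (not_lt.1 hwb) (hw0 b)
      rw [hw00, sub_zero, one_mul, zero_mul, add_zero]
      by_cases hmid : a ≤ j₀ - b ∧ T₁ < ((d - b : ℕ) : ℝ) + a
      · -- a hole cell: paid by the partner row
        have ha1 : m + b ≤ a := by
          have h2 := hmid.2; rw [hcast] at h2
          have : (m : ℝ) + b < a + 1 := by linarith
          have : m + b < a + 1 := by exact_mod_cast this
          omega
        have ha2 : a + b ≤ j₀ := by omega
        have hBa : b ≤ B a := hBmax a b hbd ha1 ha2
        have hpay : 1 / usage y T₁ (j₀ - b) (d - b) a ≤ κ a := hκhole a b (by omega) (by omega) hBa hbd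
        have hnb : ¬ (T₂ - (B a : ℝ) ≤ (b : ℝ)) := by
          intro hc
          obtain ⟨h1, h2⟩ := hB a (by omega) (by omega)
          have : m + B a + B a ≤ j₀ := by omega
          have : ((m + B a + B a : ℕ) : ℝ) ≤ j₀ := by exact_mod_cast this
          push_cast at this
          have hBb : (b : ℝ) ≤ B a := by exact_mod_cast hBa
          linarith
        rw [if_pos hmid, if_pos hBa, if_neg hnb, if_neg (show ¬ (j₀ - b + 1 ≤ a) by omega)]
        have hI : 0 ≤ (if a ≤ d - b then (1 : ℝ) else 0) := by split_ifs <;> norm_num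
        nlinarith [mul_le_mul_of_nonneg_left hpay hu0.le, hκ0 a, hu0]
      · rw [hnotmid (j₀ - b) (d - b) a hmid]
        by_cases hnb : T₂ - (B a : ℝ) ≤ (b : ℝ)
        · by_cases hk : 0 < κ a
          · obtain ⟨⟨hm1, hm2⟩, hab⟩ := hneg hnb hk
            obtain ⟨hle, hkw⟩ := hmix b a hm1 hm2 hnb
            rw [hw00] at hkw
            exact absurd (le_antisymm hkw (hκ0 a)) (ne_of_gt hk)
          · have hk0 : κ a = 0 := le_antisymm (not_lt.1 hk) (hκ0 a)
            have hPv : κ a * (y / (1 - y) * (if b ≤ B a then (1 : ℝ) else 0) - (if T₂ - (B a : ℝ) ≤ (b : ℝ) then (1 : ℝ) else 0)) = 0 := by rw [hk0]; ring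
            rw [hPv]; linarith
        · linarith [hP_nonneg_of hnb]
  · ----------------------------------------------------------------- columns b > d
    rw [if_neg hbd, zero_add, if_neg (show ¬ (a + b ≤ d) by omega), mul_zero, zero_sub]
    have hG0 : 0 ≤ (if j₀ + 1 ≤ a + b then (1 : ℝ) else 0) := by split_ifs <;> norm_num
    by_cases hnb : T₂ - (B a : ℝ) ≤ (b : ℝ)
    · by_cases hk : 0 < κ a
      · obtain ⟨_, hab⟩ := hneg hnb hk
        have hlb := hP_lb
        rw [if_pos hnb] at hlb
        rw [if_pos hab, if_pos hnb]
        linarith [hκ1 a]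
      · have hk0 : κ a = 0 := le_antisymm (not_lt.1 hk) (hκ0 a)
        have hPv : κ a * (y / (1 - y) * (if b ≤ B a then (1 : ℝ) else 0) - (if T₂ - (B a : ℝ) ≤ (b : ℝ) then (1 : ℝ) else 0)) = 0 := by rw [hk0]; ring
        rw [hPv]; linarith
    · linarith [hP_nonneg_of hnb]

end LawDec

end Quant

end Summit.CriticalPhenomena.PercolationContinuityZ3.Theorems
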